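import Summits.AnomalousDissipation.AnomalousDissipation.Theorems.MomentParityQuarticGateCoords
import Literature.MeasureTheory.Moments.TruncatedMomentPositivity

/-!
# REALIZE: strictly positive degree-4 moment data are carried by a level-`N` law
(infrastructure I3 for `MomentParity.QuarticGate`, line `recession-cone`,
stmt-AnomalousDissipation-11464)

Given an orthonormal band basis `b` of the level-`N` Galerkin space (bundle `hb`, `hbo` of
`exists_bandBasis`) and a truncated moment sequence `y` on `ℝⁿ` with `y 0 = 1` whose Riesz functional
is STRICTLY positive in degree `4` (`IsStrictlyKPositive univ 4 y`), there is a probability measure `μ`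
on `H` carried by level-`N` fields, with finite fourth moments, whose coordinate polynomial moments of
degree `≤ 4` are `L_y`: `∫ Q((u, b₁), …, (u, bₙ)) dμ = L_y(Q)` (`exists_measure_of_strictlyKPositive`).

Proof: Fialkow–Nie 2010, Thm. 1.3 (`FialkowNie2010_thm_1_3_holds`, proved in the tree) gives a
representing measure on `ℝⁿ`; push it forward along the (linear, continuous) synthesis map
`x ↦ Σ_i x_i b_i ∈ H` (`exists_synthesis`), on whose range coordinates invert the synthesis.
Also: the torus-free bookkeeping `integrable_eval_of_moments` (integral of a polynomial of degree
`≤ k` against a measure with prescribed moments is the Riesz functional).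
-/

namespace Summit.AnomalousDissipation.AnomalousDissipation.Theorems.MomentParityQuarticGate

open MeasureTheory Filter
open scoped InnerProductSpace RealInnerProductSpace ENNReal
open Literature.Analysis.FunctionSpaces Literature.Analysis.FluidPDE
open Literature.MeasureTheory.Moments
open Summit.AnomalousDissipation.AnomalousDissipation.Theses.MomentParity

set_option linter.dupNamespace false

/-! ## Moments and Riesz functionals on `ℝⁿ` (torus-free) -/

/-- `ℝⁿ` is a determining set in every degree (a real polynomial vanishing everywhere is zero).
[folklore] -/
theorem isDeterminingSet_univ (n k : ℕ) : IsDeterminingSet (Set.univ : Set (Fin n → ℝ)) k :=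
  fun _ _ hp => MvPolynomial.funext fun x => by rw [hp x (Set.mem_univ x), map_zero]

/-- **Integrating a polynomial against prescribed moments.** If `m` has the moments `y_α = ∫ x^α dm`
for `|α| ≤ k` (with integrability), then every polynomial `Q` of total degree `≤ k` is `m`-integrable
and `∫ Q dm = L_y(Q)`. [folklore] -/
theorem integrable_eval_of_moments {n k : ℕ} {m : Measure (Fin n → ℝ)} {y : (Fin n →₀ ℕ) → ℝ}
    (hm : ∀ α : Fin n →₀ ℕ, (α.sum fun _ e => e) ≤ k →
      Integrable (fun x : Fin n → ℝ => ∏ i, x i ^ α i) m ∧ ∫ x, (∏ i, x i ^ α i) ∂m = y α)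
    (Q : MvPolynomial (Fin n) ℝ) (hQ : Q.totalDegree ≤ k) :
    Integrable (fun x => MvPolynomial.eval x Q) m ∧
      ∫ x, MvPolynomial.eval x Q ∂m = rieszFunctional y Q := by
  have hdeg : ∀ α ∈ Q.support, (α.sum fun _ e => e) ≤ k := fun α hα =>
    (MvPolynomial.le_totalDegree hα).trans hQ
  have hfun : (fun x => MvPolynomial.eval x Q) =
      fun x => ∑ α ∈ Q.support, MvPolynomial.coeff α Q * ∏ i, x i ^ α i := by
    funext x
    exact MvPolynomial.eval_eq' x Q
  have hint : ∀ α ∈ Q.support,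
      Integrable (fun x : Fin n → ℝ => MvPolynomial.coeff α Q * ∏ i, x i ^ α i) m :=
    fun α hα => (hm α (hdeg α hα)).1.const_mul _
  refine ⟨by rw [hfun]; exact integrable_finsetSum _ hint, ?_⟩
  rw [hfun, integral_finsetSum _ hint]
  unfold rieszFunctional
  refine Finset.sum_congr rfl fun α hα => ?_
  rw [integral_const_mul, (hm α (hdeg α hα)).2]

/-- A measure with the moments `y`, `y 0 = 1`, is a probability measure. [folklore] -/
theorem isProbabilityMeasure_of_moments {n k : ℕ} {m : Measure (Fin n → ℝ)} {y : (Fin n →₀ ℕ) → ℝ}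
    (hm : ∀ α : Fin n →₀ ℕ, (α.sum fun _ e => e) ≤ k →
      Integrable (fun x : Fin n → ℝ => ∏ i, x i ^ α i) m ∧ ∫ x, (∏ i, x i ^ α i) ∂m = y α)
    (hy0 : y 0 = 1) : IsProbabilityMeasure m := by
  obtain ⟨h1, h2⟩ := hm 0 (by simp)
  simp only [Finsupp.coe_zero, Pi.zero_apply, pow_zero, Finset.prod_const_one] at h1 h2
  haveI : IsFiniteMeasure m := by
    rcases integrable_const_iff.1 h1 with h | h
    · exact absurd h one_ne_zero
    · exact h
  rw [integral_const, smul_eq_mul, mul_one, hy0] at h2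
  exact isProbabilityMeasure_iff_real.2 h2

/-- The energy polynomial `(Σ_i X_i²)²` has total degree `≤ 4`. [folklore] -/
theorem totalDegree_sum_X_sq_sq_le (n : ℕ) :
    ((∑ i : Fin n, MvPolynomial.X i ^ 2) ^ 2 : MvPolynomial (Fin n) ℝ).totalDegree ≤ 4 := by
  have h2 : (∑ i : Fin n, (MvPolynomial.X i ^ 2 : MvPolynomial (Fin n) ℝ)).totalDegree ≤ 2 :=
    MvPolynomial.totalDegree_finsetSum_le fun i _ => by
      rw [MvPolynomial.totalDegree_X_pow]
  calc ((∑ i : Fin n, MvPolynomial.X i ^ 2) ^ 2 : MvPolynomial (Fin n) ℝ).totalDegree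
      ≤ 2 * (∑ i : Fin n, (MvPolynomial.X i ^ 2 : MvPolynomial (Fin n) ℝ)).totalDegree :=
        MvPolynomial.totalDegree_pow _ _
    _ ≤ 2 * 2 := Nat.mul_le_mul_left 2 h2
    _ = 4 := rfl

/-! ## The realisation theorem -/

/-- **I3 — REALIZE.** For an orthonormal band basis `b` of `V_N` and a moment sequence `y` on `ℝⁿ`
with `y 0 = 1` whose Riesz functional is strictly positive in degree `4`, there is a probability
measure `μ` on `H`, carried by level-`N` fields, with `∫ ‖u‖⁴ dμ < ∞`, such that for every polynomial
`Q` of total degree `≤ 4` the coordinate observable `Q((u, bᵢ)ᵢ)` is integrable with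
`∫ Q((u, bᵢ)ᵢ) dμ = L_y(Q)`. (Fialkow–Nie 2010, Thm. 1.3, pushed forward along the synthesis map.)
[cite: FialkowNie2010, Thm. 1.3] -/
theorem exists_measure_of_strictlyKPositive :
    ∀ {N n : ℕ} {b : Fin n → UnitAddTorus (Fin 3) → EuclideanSpace ℝ (Fin 3)},
      (∀ i, Torus.IsSmooth (b i) ∧ Torus.IsDivFree (b i) ∧ Torus.HasZeroMean (b i) ∧
        ∀ k ∉ (Torus.freqBall N).erase (0 : Fin 3 → ℤ),
          UnitAddTorus.mFourierCoeff (EuclideanSpace.complexify ∘ (b i)) k = 0) →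
      (∀ i j, ∫ x, ⟪b i x, b j x⟫_ℝ = if i = j then (1 : ℝ) else 0) →
      ∀ (y : (Fin n →₀ ℕ) → ℝ), y 0 = 1 →
      Literature.MeasureTheory.Moments.IsStrictlyKPositive (Set.univ : Set (Fin n → ℝ)) 4 y →
      ∃ μ : Measure (Torus.energySpace (Fin 3)), IsProbabilityMeasure μ ∧
        (∀ᵐ u ∂μ, (∀ k ∉ (Torus.freqBall N).erase (0 : Fin 3 → ℤ),
          UnitAddTorus.mFourierCoeff (EuclideanSpace.complexify ∘
            (u.1 : UnitAddTorus (Fin 3) → EuclideanSpace ℝ (Fin 3))) k = 0)) ∧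
        Integrable (fun u : Torus.energySpace (Fin 3) => ‖u‖ ^ 4) μ ∧
        ∀ Q : MvPolynomial (Fin n) ℝ, Q.totalDegree ≤ 4 →
          Integrable (fun u : Torus.energySpace (Fin 3) =>
            MvPolynomial.eval (fun i => Torus.pairing u.1 (b i)) Q) μ ∧
          ∫ u, MvPolynomial.eval (fun i => Torus.pairing u.1 (b i)) Q ∂μ =
            Literature.MeasureTheory.Moments.rieszFunctional y Q := by
  intro N n b hb hbo y hy0 hy
  obtain ⟨m, -, hm⟩ := FialkowNie2010_thm_1_3_holds n 4 Set.univ y isClosed_univ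
    (isDeterminingSet_univ n 4) hy
  haveI := isProbabilityMeasure_of_moments hm hy0
  obtain ⟨B, hB⟩ := exists_synthesis hb hbo
  obtain ⟨L, hL⟩ : ∃ L : (Fin n → ℝ) →ₗ[ℝ] Torus.energySpace (Fin 3), ∀ x, L x = ∑ i, x i • B i :=
    ⟨∑ i, (LinearMap.proj i).smulRight (B i), fun x => by simp⟩
  have hLc : Continuous L := L.continuous_of_finiteDimensional
  have hLm : AEMeasurable L m := hLc.measurable.aemeasurable
  have hlev : ∀ x, ∀ k ∉ (Torus.freqBall N).erase (0 : Fin 3 → ℤ),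
      UnitAddTorus.mFourierCoeff (EuclideanSpace.complexify ∘
        ((L x).1 : UnitAddTorus (Fin 3) → EuclideanSpace ℝ (Fin 3))) k = 0 := fun x => by
    rw [hL x]; exact (hB x).1
  have hcoord : ∀ x, (fun i => Torus.pairing (L x).1 (b i)) = x := fun x => by
    rw [hL x]; exact (hB x).2.1
  have hnorm : ∀ x, ‖L x‖ ^ 2 = ∑ i, x i ^ 2 := fun x => by
    rw [hL x]; exact (hB x).2.2.1
  refine ⟨m.map L, Measure.isProbabilityMeasure_map hLm, ?_, ?_, fun Q hQ => ?_⟩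
  · -- carried by level-`N` fields: the range of `L` is closed, hence measurable
    have hr : MeasurableSet (Set.range L) := by
      rw [← LinearMap.coe_range]
      exact (Submodule.closed_of_finiteDimensional _).measurableSet
    filter_upwards [ae_map_mem_range L hr m] with u hu
    obtain ⟨x, rfl⟩ := hu
    exact hlev x
  · -- fourth moments: `‖L x‖⁴ = (Σ x_i²)²` is a polynomial of degree 4
    have hQeval : ∀ x : Fin n → ℝ,
        MvPolynomial.eval x ((∑ i : Fin n, MvPolynomial.X i ^ 2) ^ 2) = (∑ i, x i ^ 2) ^ 2 := by
      intro x
      simp [map_sum, map_pow]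
    have h4c : Continuous fun u : Torus.energySpace (Fin 3) => ‖u‖ ^ 4 := continuous_norm.pow 4
    rw [integrable_map_measure h4c.aestronglyMeasurable hLm]
    refine (integrable_eval_of_moments hm _ (totalDegree_sum_X_sq_sq_le n)).1.congr
      (ae_of_all _ fun x => ?_)
    simp only [Function.comp_apply]
    rw [hQeval, ← hnorm, ← pow_mul]
  · -- coordinate polynomials of degree ≤ 4
    have hcont : Continuous fun u : Torus.energySpace (Fin 3) =>
        MvPolynomial.eval (fun i => Torus.pairing u.1 (b i)) Q :=
      (MvPolynomial.continuous_eval Q).comp (continuous_coords hb)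
    have hcomp : (fun u : Torus.energySpace (Fin 3) =>
        MvPolynomial.eval (fun i => Torus.pairing u.1 (b i)) Q) ∘ L =
        fun x => MvPolynomial.eval x Q := by
      funext x
      simp only [Function.comp_apply]
      rw [hcoord x]
    obtain ⟨hi, he⟩ := integrable_eval_of_moments hm Q hQ
    refine ⟨(integrable_map_measure hcont.aestronglyMeasurable hLm).2 (by rw [hcomp]; exact hi), ?_⟩
    rw [integral_map hLm hcont.aestronglyMeasurable]
    simp_rw [hcoord]
    exact he

end Summit.AnomalousDissipation.AnomalousDissipation.Theorems.MomentParityQuarticGate
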